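import Literature.NumberTheory.Transcendental.ZilberClassAxioms
import Literature.ModelTheory.Quasiminimal.ClassCategoricity
import HarnessLib

/-!
# Zilber's categoricity theorem, reduced to the class axioms for Zilber fields

B. Zilber, *Pseudo-exponentiation on algebraically closed fields of characteristic zero*, Ann.
Pure Appl. Logic 132 (2005), Thm 1.1; M. Bays, J. Kirby, *Pseudo-exponential maps, variants, and
quasiminimality*, Algebra & Number Theory 12 (2018), Thm 1.2 = Thm 9.1. The printed proof has
two halves (see `ZilberCategoricity.lean`): (1) abstract categoricity of quasiminimal pregeometry
classes — bijections of bases extend to isomorphisms (Kirby 2010, Thm 3.3 / Haykazyan 2016,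
Thm 16, excellence by BHHKK 2014) — and (2) Zilber fields with `ecl`, in the closure-isomorphism
language, form such a class (Bays–Kirby 2013, Props 4–5).

Half (1) is now PROVED in the tree
(`Literature.ModelTheory.Quasiminimal.IsQuasiminimalPregeometryClass.exists_equiv_extend_bases`,
`ClassCategoricity.lean`). This file records the resulting reductions of the named fact
`Literature.NumberTheory.Transcendental.zilber_categoricity` (`ZilberField.lean`):

* `zilber_categoricity_of_isQuasiminimalPregeometryClass'` — `zilber_categoricity` follows from
  `IsQuasiminimalPregeometryClass Language.eclIso ZilberClass` alone;
* `zilber_categoricity_of_classAxioms` — equivalently, from the four remaining printed clauses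
  isolated in `ZilberClassAxioms.lean` (`ZilberClass.isQuasiminimalPregeometryClass_of`):
  uniqueness of `ecl(∅)` (Kirby 2013, Cor. 6.10), `ecl`-closed E-subfields of Zilber fields are
  Zilber fields (Bays–Kirby 2013, Prop. 4), and the two clauses of `ℵ₀`-homogeneity over
  countable closed subsets across two Zilber fields (Bays–Kirby 2013, Prop. 5).

No named fact is introduced; nothing here is conditional beyond the displayed hypotheses.

## References

* B. Zilber, Ann. Pure Appl. Logic 132 (2005) 67–95: Thm 1.1.
* M. Bays, J. Kirby, Algebra & Number Theory 12 (2018) 493–549: Thm 1.2, Thm 9.1.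
* M. Bays, J. Kirby, arXiv:1305.0493 (2013): Thm 1, Props 4–5.
* J. Kirby, J. Symbolic Logic 75 (2010) 551–564: Thm 3.3, Cor. 3.4.
* L. Haykazyan, J. Symbolic Logic 81 (2016) 56–64: Thm 16.
* M. Bays, B. Hart, T. Hyttinen, M. Kesälä, J. Kirby, Bull. LMS 46 (2014): Thm 2.3, Prop. 6.2.
-/

noncomputable section

open Set
open FirstOrder FirstOrder.Language
open Literature.ModelTheory.ExponentialFields Literature.ModelTheory.Quasiminimal

namespace Literature.NumberTheory.Transcendental

/-- **Zilber's categoricity theorem from the class axioms** (the abstract half discharged): if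
the class of Zilber fields with `ecl`, in the closure-isomorphism language `Language.eclIso`, is a
quasiminimal pregeometry class in the sense of Haykazyan's Def. 2, then any two Zilber fields of
the same uncountable cardinality are isomorphic exponential fields. The extension of bijections
of bases to isomorphisms (hypothesis `h16` of
`zilber_categoricity_of_isQuasiminimalPregeometryClass`) is Kirby 2010, Thm 3.3 / Haykazyan 2016,
Thm 16, proved in `ClassCategoricity.lean`.
[cite: Zilber2005PseudoExp, Thm 1.1] [cite: BaysKirby2018ANT, Thm 9.1]
[cite: Kirby2010QMEC, Thm 3.3] [cite: Haykazyan2016, Theorem 16] -/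
theorem zilber_categoricity_of_isQuasiminimalPregeometryClass'
    (h𝒞 : IsQuasiminimalPregeometryClass Language.eclIso ZilberClass) : zilber_categoricity :=
  zilber_categoricity_of_isQuasiminimalPregeometryClass h𝒞
    (fun hH hH' _ _ _ _ hB hBsp hB' hB'sp e =>
      h𝒞.exists_equiv_extend_bases hH hH' hB hBsp hB' hB'sp e)

/-- **Zilber's categoricity theorem from the four remaining printed clauses** of "Zilber fields
form a quasiminimal pregeometry class" (`ZilberClass.isQuasiminimalPregeometryClass_of`,
`ZilberClassAxioms.lean`): `h₂` uniqueness of `ecl(∅)` up to isomorphism (Kirby, *Finitely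
presented exponential fields*, Algebra & Number Theory 7 (2013), Cor. 6.10), `h₃` `ecl`-closed
E-subfields of Zilber fields are Zilber fields (Bays–Kirby 2013, Prop. 4), `h₄₃`/`h₄₄`
`ℵ₀`-homogeneity over countable closed subsets across two Zilber fields (Bays–Kirby 2013,
Prop. 5; Kirby 2010, Thm 2.1 and Prop. 3.5). [cite: Zilber2005PseudoExp, Thm 1.1]
[cite: BaysKirby2013Excellence, Props 4–5] [cite: BaysKirby2018ANT, Thm 9.1] -/
theorem zilber_categoricity_of_classAxioms
    (h₂ : ∀ {K K' : Type} [Field K] [CharZero K] [ExponentialRing K] [Field K'] [CharZero K']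
      [ExponentialRing K'], IsZilberField K → IsZilberField K' →
        ∃ φ : ExponentialRingHom (Khovanskii.eclSubfield (∅ : Set K)) K', Set.range φ = ecl ∅)
    (h₃ : ∀ {K : Type} [Field K] [CharZero K] [ExponentialRing K],
      IsZilberField K → ∀ X : Set K, IsZilberField (Khovanskii.eclSubfield X))
    (h₄₃ : ∀ {H H' : Type} [Language.eclIso.Structure H] [Language.eclIso.Structure H']
      {cl : Set H → Set H} {cl' : Set H' → Set H'}, ZilberClass H cl → ZilberClass H' cl' →
        ∀ (G : Set H) (g : H → H'), G.Countable → cl G = G → cl' (g '' G) = g '' G →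
          IsPartialEmbOn Language.eclIso g G → ∀ ⦃x : H⦄ ⦃x' : H'⦄, x ∉ cl G → x' ∉ cl' (g '' G) →
            Language.eclIso.EqQFTypeOver₂ G g ![x] ![x'])
    (h₄₄ : ∀ {H H' : Type} [Language.eclIso.Structure H] [Language.eclIso.Structure H']
      {cl : Set H → Set H} {cl' : Set H' → Set H'}, ZilberClass H cl → ZilberClass H' cl' →
        ∀ (G : Set H) (g : H → H'), G.Countable → cl G = G → cl' (g '' G) = g '' G →
          ∀ ⦃n : ℕ⦄ (x : Fin n → H) (x' : Fin n → H'), Language.eclIso.EqQFTypeOver₂ G g x x' →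
            ∀ ⦃y : H⦄, y ∈ cl (G ∪ Set.range x) →
              ∃ y' : H', Language.eclIso.EqQFTypeOver₂ G g (Fin.snoc x y : Fin (n + 1) → H)
                (Fin.snoc x' y')) :
    zilber_categoricity :=
  zilber_categoricity_of_isQuasiminimalPregeometryClass'
    (ZilberClass.isQuasiminimalPregeometryClass_of h₂ h₃ h₄₃ h₄₄)

end Literature.NumberTheory.Transcendental

end
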